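import Summits.BirchSwinnertonDyer.BirchSwinnertonDyer.Theorems.SignedLowerHalvesSmallImageLowerHalfBothSignsRttD2SeqJ3Finite
import Literature.NumberTheory.GaloisRepresentations.ContinuousShapiroOpenCoinduced
import Literature.NumberTheory.GaloisRepresentations.ContinuousRepHomDual
import Literature.NumberTheory.GaloisRepresentations.LocalDualityDescent
import Literature.GroupTheory.FiniteAbelian.HomCounts
import HarnessLib

/-!
# Route `SignedLowerHalves`, crux L `SmallImageLowerHalfBothSigns` (stmt-BirchSwinnertonDyer-23599), line `rtt_w3` v30 — stub S3α′ (`stub_junctionShaPT_ns`),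
# brick α2-lev (part 1, generic counts): EQUIVARIANT HOMOMORPHISMS OUT OF A COINDUCED MODULE ARE DETERMINED ON ORBIT REPRESENTATIVES, and the `p^m`-torsion of `𝒪 ⊗ μ_{p^k}`

INPUTS hand `bsd-inputs-honda-p1` g28 under LEAD `cruxlead-stmt-BirchSwinnertonDyer-23599` g14 (cell `bsd-ssimc`; TAKE-GRANT 2026-08-31T06:30Z «α2-lev = the levelwise uniform bound
`Nat.card (semilocCoh S κc θ′ P w n k 2) ≤ B_w`»); helper `--supports stmt-BirchSwinnertonDyer-23599`. THEOREMS ONLY (no definition, no named fact, no instance, no `sorry`).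
WHY. By local Tate duality in bidegree `(2,0)` (tree `natCard_two_eq_natCard_invariants_homRep`) the level `(n,k)` of the degree-2 semilocal Iwasawa module at `w` has the cardinality of
`Hom_{Γ_{K_w}}(Maps(Γ_K ⧸ U_n, X_k), μ_{p^k})`; this file supplies the two generic counts that bound it UNIFORMLY in `n` and `k` (part 2, `…RttJunctionShaLocCount`, assembles them):
* §1 finite abelian groups: `#ker φ = #(A ⧸ range φ)`; `#Hom(A, Ω) ≤ #A` for `Ω ≃ ℤ/n` (tree `natCard_addMonoidHom_zmod_right`); ★ `natCard_subtype_comp_eq_zero_le_natCard_ker`: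
  `#{g : A →+ Ω | g ∘ φ = 0} ≤ #ker φ`.
* §2 ★★ `natCard_invariants_homRep_coindOpen_le` — for `ρ : G → Aut(M)`, `N ≤ G` open, `θ : D → G` and a `D`-module `Ω`: if every coset of `G ⧸ N` is `θ(h) • r_i` (`h ∈ D`, `r_i` in a finite
  family `ι`) and `τ ∈ D` acts trivially on `G ⧸ N`, then `#Hom_D(Maps(G ⧸ N, M)|_θ, Ω) ≤ #{g : M →+ Ω | g ∘ ρ(θτ) = ω(τ) ∘ g} ^ #ι` (`f ↦ (f ∘ δ_{r_i})_i` is injective — the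
  counted form of Mackey/Frobenius reciprocity `Hom_D(⊕_orbits Ind, Ω) = Π Hom_{Stab}(M, Ω)`).
* §3 ★ `natCard_torsionBy_oMuCarrier_le` — `#(𝒪 ⊗ μ_{p^k}(K̄))[p^m] ≤ #(𝒪 ⧸ p^m 𝒪)` for every `k` (`𝒪 ⊗ μ_{p^k}` is generated by one pure tensor, `exists_forall_eq_tmul`; `#ker = #coker`).
HONEST FRAMING: counting lemmas; nothing about S3α′, E2, crux L or BSD is proved; all remain OPEN and are proved for NO curve.
References: [NeukirchSchmidtWingberg2008] I §5 (1.5.6)–(1.5.7), I §6 (1.6.4); [Brown1982] III §5 (5.6)(b); [MilneADT2006] I §0, Cor. 2.3; [Hungerford1974] Ch. IV §4; [NeukirchANT1999] Ch. II (4.8).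
-/

set_option autoImplicit false
set_option linter.dupNamespace false -- D-0017: single-problem summit, the namespace repeats the problem name by design
noncomputable section

open scoped Classical TensorProduct
open Function

namespace Summit.BirchSwinnertonDyer.BirchSwinnertonDyer.Theorems.SmallImageRttJunctionSha

open Literature.NumberTheory.GaloisRepresentations Literature.NumberTheory.GaloisRepresentations.DiscreteGaloisModule
  Literature.NumberTheory.EllipticCurves
  Literature.NumberTheory.ComplexMultiplication.EllipticUnits.JohnsonLeungKings2011

/-! ## §1 Finite abelian groups -/

section FiniteGroup

variable {A Ω : Type*} [AddCommGroup A] [AddCommGroup Ω]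

/-- For an endomorphism `f` of a finite abelian group, `#ker f = #(A ⧸ range f)`. [folklore] -/
theorem natCard_ker_eq_natCard_quotient_range [Finite A] (f : A →+ A) : Nat.card f.ker = Nat.card (A ⧸ f.range) := by
  have h1 := AddSubgroup.card_eq_card_quotient_mul_card_addSubgroup f.range
  have h2 := AddSubgroup.card_eq_card_quotient_mul_card_addSubgroup f.ker
  have h3 : Nat.card (A ⧸ f.ker) = Nat.card f.range := Nat.card_congr (QuotientAddGroup.quotientKerEquivRange f).toEquiv
  rw [h3] at h2
  have hpos : 0 < Nat.card f.range := Nat.card_pos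
  have : Nat.card (A ⧸ f.range) * Nat.card f.range = Nat.card f.range * Nat.card f.ker := h1.symm.trans h2
  rw [mul_comm] at this
  exact (Nat.eq_of_mul_eq_mul_left hpos this).symm

/-- `#Hom(A, Ω) ≤ #A` when `Ω ≃ ℤ/n` (`#Hom(A, ℤ/n) = #A[n]`). [cite: Hungerford1974, Ch. IV §4 Exercise 1] -/
theorem natCard_addMonoidHom_le_of_addEquiv_zmod [Finite A] {n : ℕ} [NeZero n] (e : Ω ≃+ ZMod n) : Nat.card (A →+ Ω) ≤ Nat.card A := by
  have h : Nat.card (A →+ Ω) = Nat.card (A →+ ZMod n) :=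
    Nat.card_congr (e.addMonoidHomCongrRight : (A →+ Ω) ≃+ (A →+ ZMod n)).toEquiv
  rw [h, Literature.GroupTheory.FiniteAbelian.natCard_addMonoidHom_zmod_right]
  exact Nat.card_le_card_of_injective _ (AddSubgroup.subtype_injective _)

/-- The additive maps killing `range φ` inject into `Hom(A ⧸ range φ, Ω)`. [folklore] -/
theorem natCard_subtype_comp_eq_zero_le [Finite A] [Finite Ω] (φ : A →+ A) :
    Nat.card {g : A →+ Ω // ∀ x, g (φ x) = 0} ≤ Nat.card (A ⧸ φ.range →+ Ω) := by
  haveI : Finite (A ⧸ φ.range →+ Ω) := Finite.of_injective (fun g ↦ (g : A ⧸ φ.range → Ω)) DFunLike.coe_injective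
  refine Nat.card_le_card_of_injective (fun g ↦ QuotientAddGroup.lift φ.range g.1 (fun x hx ↦ ?_)) ?_
  · obtain ⟨y, rfl⟩ := hx
    exact g.2 y
  · intro g g' h
    apply Subtype.ext
    ext x
    have := congrArg (fun (F : A ⧸ φ.range →+ Ω) ↦ F (QuotientAddGroup.mk x)) h
    simpa using this

/-- ★ **`#{g : A →+ Ω | g ∘ φ = 0} ≤ #ker φ`** for an endomorphism `φ` of a finite abelian group `A` and `Ω ≃ ℤ/n`. [folklore] -/
theorem natCard_subtype_comp_eq_zero_le_natCard_ker [Finite A] [Finite Ω] {n : ℕ} [NeZero n] (e : Ω ≃+ ZMod n) (φ : A →+ A) :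
    Nat.card {g : A →+ Ω // ∀ x, g (φ x) = 0} ≤ Nat.card φ.ker :=
  (natCard_subtype_comp_eq_zero_le φ).trans ((natCard_addMonoidHom_le_of_addEquiv_zmod e).trans (natCard_ker_eq_natCard_quotient_range φ).symm.le)

end FiniteGroup


/-! ## §2 Equivariant homomorphisms out of a coinduced module -/

section Equivariant

variable {G : Type} [Group G] [TopologicalSpace G] [IsTopologicalGroup G] [CompactSpace G]
  {M : Type} [AddCommGroup M] [TopologicalSpace M] [DiscreteTopology M] [Finite M]
  (ρ : ContinuousRep G ℤ M) (N : Subgroup G) (hN : IsOpen (N : Set G))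
  {D : Type} [Group D] [TopologicalSpace D] [IsTopologicalGroup D] (θ : D →ₜ* G)
  {Ω : Type} [AddCommGroup Ω] [TopologicalSpace Ω] [DiscreteTopology Ω] [Finite Ω] (ω : ContinuousRep D ℤ Ω)

omit [Finite M] [IsTopologicalGroup D] in
/-- The action of `Maps(G ⧸ N, M)` restricted along `θ` on a function supported at one coset: `h ⋆ δ_c(x) = δ_{θ(h) c}(θ(h) x)`. [cite: NeukirchSchmidtWingberg2008, I §6] -/
theorem coindOpen_restrict_single (h : D) (c : G ⧸ N) (x : M) :
    ((ρ.coindOpen N hN).restrict θ) h (Pi.single c x) = Pi.single (θ h • c) (ρ (θ h) x) := by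
  funext y
  rw [ContinuousRep.restrict_apply, ContinuousRep.coindOpen_apply_apply]
  by_cases hy : y = θ h • c
  · subst hy
    rw [inv_smul_smul, Pi.single_eq_same, Pi.single_eq_same]
  · have hy' : (θ h)⁻¹ • y ≠ c := fun h' ↦ hy (by rw [← h', smul_inv_smul])
    rw [Pi.single_eq_of_ne hy', Pi.single_eq_of_ne hy, map_zero]

/-- ★ **Equivariant homomorphisms out of `Maps(G ⧸ N, M)|_θ` are determined on orbit representatives**: if every coset `y ∈ G ⧸ N` is `θ(h) • r_i` for some `h ∈ D` and some
member `r_i` of a finite family, and `τ ∈ D` acts trivially on `G ⧸ N`, then `f ↦ (f ∘ δ_{r_i})_i` injects the `D`-invariants of `Hom(Maps(G ⧸ N, M), Ω)` into families of additive maps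
`g : M → Ω` with `g(θ(τ) x) = τ g(x)`; hence `#Hom_D(Maps(G ⧸ N, M), Ω) ≤ #{g : M →+ Ω | g ∘ θ(τ) = τ ∘ g} ^ #ι` (Frobenius reciprocity / Mackey, counted).
[cite: NeukirchSchmidtWingberg2008, I §5 (1.5.6)–(1.5.7), I §6 (1.6.4)] [cite: Brown1982, III §5 (5.6)(b)] -/
theorem natCard_invariants_homRep_coindOpen_le {ι : Type} [Fintype ι] (r : ι → G ⧸ N) (hr : ∀ y : G ⧸ N, ∃ (h : D) (i : ι), y = θ h • r i)
    (τ : D) (hτ : ∀ y : G ⧸ N, θ τ • y = y) :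
    haveI := ContinuousRep.discreteTopology_coindOpen (M := M) N hN
    haveI := ContinuousRep.finite_coindOpen (M := M) N hN
    Nat.card (((ρ.coindOpen N hN).restrict θ).homRep ω).toTopRep.ρ.invariants ≤
      Nat.card {g : M →+ Ω // ∀ x, g (ρ (θ τ) x) = ω τ (g x)} ^ Fintype.card ι := by
  haveI := ContinuousRep.discreteTopology_coindOpen (M := M) N hN
  haveI := ContinuousRep.finite_coindOpen (M := M) N hN
  haveI : Finite (G ⧸ N) := Subgroup.quotient_finite_of_isOpen N hN
  letI : Fintype (G ⧸ N) := Fintype.ofFinite _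
  haveI : Finite (M →+ Ω) := Finite.of_injective (fun g ↦ (g : M → Ω)) DFunLike.coe_injective
  let ρ' := (ρ.coindOpen N hN).restrict θ
  have hsingle : ∀ (h : D) (c : G ⧸ N) (x : M), ρ' h (Pi.single c x) = Pi.single (θ h • c) (ρ (θ h) x) :=
    coindOpen_restrict_single ρ N hN θ
  -- the equivariance identity of an invariant `f`
  have hinv : ∀ f : (ρ'.homRep ω).toTopRep.ρ.invariants, ∀ (h : D) (m : G ⧸ N → M),
      ω h ((f : HomCarrier (G ⧸ N → M) Ω) m) = (f : HomCarrier (G ⧸ N → M) Ω) (ρ' h m) := fun f h ↦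
    (ContinuousRep.homRep_apply_eq_self_iff ρ' ω h (f : HomCarrier (G ⧸ N → M) Ω)).mp (f.2 h)
  -- the map to families
  let Φ : (ρ'.homRep ω).toTopRep.ρ.invariants → (ι → {g : M →+ Ω // ∀ x, g (ρ (θ τ) x) = ω τ (g x)}) := fun f i ↦
    ⟨((f : HomCarrier (G ⧸ N → M) Ω) : (G ⧸ N → M) →+ Ω).comp (AddMonoidHom.single (fun _ : G ⧸ N ↦ M) (r i)), fun x ↦ by
      change (f : HomCarrier (G ⧸ N → M) Ω) (Pi.single (r i) (ρ (θ τ) x)) = ω τ ((f : HomCarrier (G ⧸ N → M) Ω) (Pi.single (r i) x))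
      rw [hinv f τ, hsingle, hτ]⟩
  have hΦ : Function.Injective Φ := by
    intro f f' hff'
    apply Subtype.ext
    refine AddMonoidHom.functions_ext _ _ _ fun y x ↦ ?_
    obtain ⟨h, i, rfl⟩ := hr y
    have key : ∀ F : (ρ'.homRep ω).toTopRep.ρ.invariants,
        (F : HomCarrier (G ⧸ N → M) Ω) (Pi.single (θ h • r i) x) = ω h ((F : HomCarrier (G ⧸ N → M) Ω) (Pi.single (r i) (ρ (θ h⁻¹) x))) := by
      intro F
      rw [hinv F h, hsingle, ← ContinuousRep.restrict_apply ρ θ h, ← ContinuousRep.restrict_apply ρ θ h⁻¹,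
        ← Module.End.mul_apply, ← map_mul, mul_inv_cancel, map_one, Module.End.one_apply]
    have hi := congrArg (fun F : ι → {g : M →+ Ω // ∀ x, g (ρ (θ τ) x) = ω τ (g x)} ↦ ((F i : {g : M →+ Ω // _}) : M →+ Ω) (ρ (θ h⁻¹) x)) hff'
    change (f : HomCarrier (G ⧸ N → M) Ω) (Pi.single (r i) (ρ (θ h⁻¹) x)) = (f' : HomCarrier (G ⧸ N → M) Ω) (Pi.single (r i) (ρ (θ h⁻¹) x)) at hi
    change (f : HomCarrier (G ⧸ N → M) Ω) (Pi.single (θ h • r i) x) = (f' : HomCarrier (G ⧸ N → M) Ω) (Pi.single (θ h • r i) x)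
    rw [key f, key f', hi]
  calc Nat.card (ρ'.homRep ω).toTopRep.ρ.invariants
      ≤ Nat.card (ι → {g : M →+ Ω // ∀ x, g (ρ (θ τ) x) = ω τ (g x)}) := Nat.card_le_card_of_injective Φ hΦ
    _ = Nat.card {g : M →+ Ω // ∀ x, g (ρ (θ τ) x) = ω τ (g x)} ^ Fintype.card ι := by
        rw [Nat.card_fun, Nat.card_eq_fintype_card (α := ι)]

end Equivariant


/-! ## §3 The `p^m`-torsion of `𝒪 ⊗ μ_{p^k}` is bounded by `#(𝒪 / p^m)` -/

section OMu

variable {K : Type} [Field K] [NumberField K] {p : ℕ} [Fact p.Prime] (S : Set (PadicAlgCl p))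

/-- **`𝒪 ⊗ μ_{p^k}(K̄)` is generated by one pure tensor `1 ⊗ ζ`**: for a generator `ζ` of the cyclic group `μ_{p^k}(K̄)` every element is `a ⊗ ζ`, `a ∈ 𝒪`. [folklore] -/
theorem exists_forall_eq_tmul (k : ℕ) : ∃ ζ : MuCarrier K (p ^ k), ∀ x : OMuCarrier K S (p ^ k), ∃ a : padicCoeffIntegers S, x = OMuCarrier.tmul a ζ := by
  haveI : NeZero (p ^ k) := ⟨pow_ne_zero _ (Fact.out : p.Prime).ne_zero⟩
  let e := muEquivZMod K (p ^ k)
  refine ⟨e.symm 1, fun x ↦ ?_⟩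
  have hv : ∀ v : MuCarrier K (p ^ k), v = ((e v).val : ℤ) • e.symm 1 := fun v ↦ by
    apply e.injective
    rw [map_zsmul, e.apply_symm_apply, zsmul_eq_mul, mul_one, Int.cast_natCast, ZMod.natCast_zmod_val]
  induction x using OMuCarrier.induction_on with
  | zero => exact ⟨0, by
      change (0 : OMuCarrier K S (p ^ k)) = OMuCarrier.toTensor.symm ((0 : padicCoeffIntegers S) ⊗ₜ e.symm 1)
      rw [TensorProduct.zero_tmul]; rfl⟩
  | tmul a v =>
    refine ⟨((e v).val : ℤ) • a, ?_⟩
    conv_lhs => rw [hv v]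
    change OMuCarrier.toTensor.symm (a ⊗ₜ (((e v).val : ℤ) • e.symm 1)) = OMuCarrier.toTensor.symm ((((e v).val : ℤ) • a) ⊗ₜ e.symm 1)
    rw [TensorProduct.tmul_smul, TensorProduct.smul_tmul']
  | add x y hx hy =>
    obtain ⟨a, rfl⟩ := hx
    obtain ⟨b, rfl⟩ := hy
    refine ⟨a + b, ?_⟩
    change OMuCarrier.toTensor.symm (a ⊗ₜ e.symm 1) + OMuCarrier.toTensor.symm (b ⊗ₜ e.symm 1) = OMuCarrier.toTensor.symm ((a + b) ⊗ₜ e.symm 1)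
    rw [TensorProduct.add_tmul, map_add]

/-- ★ **`#(𝒪 ⊗ μ_{p^k})[p^m] ≤ #(𝒪 / p^m 𝒪)`**, uniformly in `k`: the `p^m`-torsion of the finite group `𝒪 ⊗ μ_{p^k}` has the cardinality of the cokernel of `p^m`, a quotient of `𝒪/p^m` through
`a ↦ a ⊗ ζ`. [cite: NeukirchANT1999, Ch. II (4.8)] [folklore] -/
theorem natCard_torsionBy_oMuCarrier_le [FiniteDimensional ℚ_[p] (padicCoeffField S)] (k m : ℕ) :
    Nat.card (nsmulAddMonoidHom (α := OMuCarrier K S (p ^ k)) (p ^ m)).ker ≤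
      Nat.card (padicCoeffIntegers S ⧸ (Ideal.span {((p : ℕ) : padicCoeffIntegers S) ^ m} : Ideal (padicCoeffIntegers S))) := by
  haveI := SmallImageRttD2Seq.finite_oMuCarrier (K := K) S k
  haveI := LambdaLowerBoundO.finite_quotient_span_natCast_prime_pow_padicCoeffIntegers S m
  set φ : OMuCarrier K S (p ^ k) →+ OMuCarrier K S (p ^ k) := nsmulAddMonoidHom (p ^ m)
  rw [natCard_ker_eq_natCard_quotient_range φ]
  obtain ⟨ζ, hζ⟩ := exists_forall_eq_tmul (K := K) S k
  -- `a ↦ [a ⊗ ζ]`, a surjection `𝒪 → (𝒪 ⊗ μ) ⧸ p^m` killing `p^m 𝒪`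
  let ψ : padicCoeffIntegers S →+ OMuCarrier K S (p ^ k) :=
    { toFun := fun a ↦ OMuCarrier.tmul a ζ
      map_zero' := by
        change OMuCarrier.toTensor.symm ((0 : padicCoeffIntegers S) ⊗ₜ ζ) = 0
        rw [TensorProduct.zero_tmul]; rfl
      map_add' := fun a b ↦ by
        change OMuCarrier.toTensor.symm ((a + b) ⊗ₜ ζ) = OMuCarrier.toTensor.symm (a ⊗ₜ ζ) + OMuCarrier.toTensor.symm (b ⊗ₜ ζ)
        rw [TensorProduct.add_tmul, map_add] }
  let f : padicCoeffIntegers S →+ OMuCarrier K S (p ^ k) ⧸ φ.range := (QuotientAddGroup.mk' φ.range).comp ψ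
  have hf : Function.Surjective f := by
    intro q
    induction q using QuotientAddGroup.induction_on with
    | H x =>
      obtain ⟨a, rfl⟩ := hζ x
      exact ⟨a, rfl⟩
  have hI : (Ideal.span {((p : ℕ) : padicCoeffIntegers S) ^ m} : Ideal (padicCoeffIntegers S)).toAddSubgroup ≤ f.ker := by
    intro a ha
    rw [Submodule.mem_toAddSubgroup, Ideal.mem_span_singleton] at ha
    obtain ⟨b, rfl⟩ := ha
    rw [AddMonoidHom.mem_ker]
    change QuotientAddGroup.mk (OMuCarrier.tmul (((p : ℕ) : padicCoeffIntegers S) ^ m * b) ζ) = (0 : OMuCarrier K S (p ^ k) ⧸ φ.range)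
    rw [QuotientAddGroup.eq_zero_iff]
    refine ⟨OMuCarrier.tmul b ζ, ?_⟩
    change (p ^ m) • OMuCarrier.toTensor.symm (b ⊗ₜ ζ) = OMuCarrier.toTensor.symm (((((p : ℕ) : padicCoeffIntegers S) ^ m * b)) ⊗ₜ ζ)
    rw [← map_nsmul, TensorProduct.smul_tmul', nsmul_eq_mul, Nat.cast_pow]
  have h1 : Nat.card (OMuCarrier K S (p ^ k) ⧸ φ.range) = f.ker.index := by
    rw [AddSubgroup.index_eq_card]
    exact Nat.card_congr (QuotientAddGroup.quotientKerEquivOfSurjective f hf).symm.toEquiv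
  rw [h1]
  have h2 : (Ideal.span {((p : ℕ) : padicCoeffIntegers S) ^ m} : Ideal (padicCoeffIntegers S)).toAddSubgroup.index =
      Nat.card (padicCoeffIntegers S ⧸ (Ideal.span {((p : ℕ) : padicCoeffIntegers S) ^ m} : Ideal (padicCoeffIntegers S))) :=
    AddSubgroup.index_eq_card _
  have hne : (Ideal.span {((p : ℕ) : padicCoeffIntegers S) ^ m} : Ideal (padicCoeffIntegers S)).toAddSubgroup.index ≠ 0 := by
    rw [h2]; exact Nat.card_pos.ne'
  rw [← h2]
  exact Nat.le_of_dvd (Nat.pos_of_ne_zero hne) (AddSubgroup.index_dvd_of_le hI)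

end OMu


end Summit.BirchSwinnertonDyer.BirchSwinnertonDyer.Theorems.SmallImageRttJunctionSha

end
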